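import Summits.Ventures.DiscreteObjects.PP12.PrimeOrderSummaryFano
import Summits.Ventures.DiscreteObjects.PP12.OrderThree
import Summits.Ventures.DiscreteObjects.PP12.FixedPointsEqFixedLines

/-!
# PP(12): the prime-order atlas — fixed structure of every prime-order collineation, all primes (kernel capstone)
Framing: lottery ticket; floor = certified bounds/negative ranges.

`prime_order_atlas_order12` extends `prime_order_structure_order12'` (p221186: primes `≥ 5`) by the two LIVE primes of the
census (cell pub-namedobj, target M): `p = 2` (`Involution.lean`: every involution is an elation, 13/13) and `p = 3`
(`OrderThree.lean`: elation 13/13 — excluded in print, Janko–van Trung 1981 — or planar of order 3, 13/13 with 4/4, or flag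
type with `f ∈ {1,4,7,10}`), and records Baer's equality `#fixed lines = #fixed points` (`FixedPointsEqFixedLines.lean`) for
all of them. For a projective plane of order 12 (Mathlib `Configuration.ProjectivePlane`) and a collineation `σ ≠ 1` with
`σ ^ p = 1` on points, `p` prime, the fixed structure is therefore one of an explicit finite list of numerical types; the list
entries NOT excluded in print are exactly: `p = 2` elation; `p = 3` planar; `p = 3` flag type `f = g ∈ {1,4,7,10}` — the
'beyond bound k' cells of NAMEDOBJ-TABLE (M, family B1), now typed in the kernel. Everything here is proved; nothing is assumed.
-/

namespace Summit.Ventures.DiscreteObjects.PP12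

open Configuration Finset
open scoped Classical

namespace Collineation

variable {P L : Type*} [Membership P L] [ProjectivePlane P L] [Fintype P] [Fintype L]
  [DecidableEq P] [DecidableEq L] (σ : Collineation P L)

/-- **Prime-order atlas for a projective plane of order 12.** See the module docstring. -/
theorem prime_order_atlas_order12 (h12 : ProjectivePlane.order P L = 12) (hne : σ.onPoints ≠ 1) {p : ℕ}
    (hp : p.Prime) (hq : σ.onPoints ^ p = 1) :
    fixedCard σ.onLines = fixedCard σ.onPoints ∧
    ((p = 2 ∧ ∃ (l : L) (c : P), σ.IsAxis l ∧ σ.IsCenter c ∧ c ∈ l ∧ fixedCard σ.onPoints = 13) ∨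
     (p = 3 ∧ ((∃ (l : L) (c : P), σ.IsAxis l ∧ σ.IsCenter c ∧ c ∈ l ∧ fixedCard σ.onPoints = 13) ∨
       (fixedCard σ.onPoints = 13 ∧ (∀ l : L, σ.onLines l = l → σ.fixedOnLine l = 4) ∧
         (∀ x : P, σ.onPoints x = x → σ.fixedThrough x = 4)) ∨
       (∃ (l : L) (c : P), σ.onLines l = l ∧ σ.onPoints c = c ∧ c ∈ l ∧ (∀ x : P, σ.onPoints x = x → x ∈ l) ∧
         (∀ m : L, σ.onLines m = m → c ∈ m) ∧
         (fixedCard σ.onPoints = 1 ∨ fixedCard σ.onPoints = 4 ∨ fixedCard σ.onPoints = 7 ∨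
           fixedCard σ.onPoints = 10)))) ∨
     (p = 5 ∧ fixedCard σ.onPoints = 7 ∧
       (∀ l : L, σ.onLines l = l → σ.fixedOnLine l = 3) ∧ (∀ x : P, σ.onPoints x = x → σ.fixedThrough x = 3)) ∨
     (p = 11 ∧ ((∃ (l : L) (c : P), σ.IsAxis l ∧ σ.IsCenter c ∧ c ∉ l ∧ fixedCard σ.onPoints = 14) ∨
       (fixedCard σ.onPoints = 3 ∧ ∀ l : L, σ.onLines l = l → ∀ [DecidablePred (· ∈ l)], σ.fixedOnLine l = 2))) ∨
     (p = 13 ∧ (∃! x : P, σ.onPoints x = x) ∧ (∃! l : L, σ.onLines l = l) ∧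
       ∀ (x : P) (l : L), σ.onPoints x = x → σ.onLines l = l → x ∉ l) ∨
     (p = 157 ∧ fixedCard σ.onPoints = 0)) := by
  refine ⟨σ.fixedCard_points_eq_lines.symm, ?_⟩
  rcases σ.prime_order_structure_order12' h12 hne hp hq with h2 | h3 | h5 | h11 | h13 | h157
  · subst h2
    obtain ⟨l, c, hl, hc, hcl⟩ := σ.elation_of_sq h12 hne hq
    exact Or.inl ⟨rfl, l, c, hl, hc, hcl, (σ.fixedCard_eq_13_of_sq h12 hne hq).1⟩
  · subst h3
    refine Or.inr (Or.inl ⟨rfl, ?_⟩)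
    rcases σ.order_three_structure h12 hne hq with ⟨l, c, hl, hc, hcl, hf, -⟩ | ⟨hf, -, hk, ht⟩ |
        ⟨l, c, hl, hc, hcl, hall, hall', hf, -⟩
    · exact Or.inl ⟨l, c, hl, hc, hcl, hf⟩
    · exact Or.inr (Or.inl ⟨hf, hk, ht⟩)
    · exact Or.inr (Or.inr ⟨l, c, hl, hc, hcl, hall, hall', hf⟩)
  · obtain ⟨h5', hf, -, hk, ht⟩ := h5
    exact Or.inr (Or.inr (Or.inl ⟨h5', hf, hk, ht⟩))
  · obtain ⟨h11', h⟩ := h11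
    refine Or.inr (Or.inr (Or.inr (Or.inl ⟨h11', ?_⟩)))
    rcases h with h | ⟨hf, -, hk⟩
    · exact Or.inl h
    · exact Or.inr ⟨hf, hk⟩
  · exact Or.inr (Or.inr (Or.inr (Or.inr (Or.inl h13))))
  · exact Or.inr (Or.inr (Or.inr (Or.inr (Or.inr h157))))

/-- **The live cells, numerically.** On a projective plane of order 12, a non-trivial collineation WITHOUT an axis is
never an involution (`σ² ≠ 1`); and if it has order 3 it fixes as many lines as points, namely `13` (planar of order 3)
or `1, 4, 7, 10` (flag type). These axis-free order-2/3 types, together with the order-2 elation, are the census cells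
not excluded in print. -/
theorem no_axis_two_three_order12 (h12 : ProjectivePlane.order P L = 12) (hne : σ.onPoints ≠ 1)
    (hax : ∀ l : L, ¬ σ.IsAxis l) :
    (σ.onPoints ^ 2 ≠ 1) ∧
    (σ.onPoints ^ 3 = 1 → fixedCard σ.onLines = fixedCard σ.onPoints ∧
      (fixedCard σ.onPoints = 13 ∨ fixedCard σ.onPoints = 1 ∨ fixedCard σ.onPoints = 4 ∨
        fixedCard σ.onPoints = 7 ∨ fixedCard σ.onPoints = 10)) := by
  refine ⟨fun hq => ?_, fun hq => ⟨σ.fixedCard_points_eq_lines.symm, ?_⟩⟩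
  · obtain ⟨l, hl⟩ := σ.exists_axis_of_sq h12 hne hq
    exact hax l hl
  · rcases σ.planar_or_flag_of_no_axis_q3 h12 hq hax with ⟨hf, -⟩ | ⟨-, -, -, -, -, -, -, hf, -⟩
    · exact Or.inl hf
    · exact Or.inr hf

end Collineation

end Summit.Ventures.DiscreteObjects.PP12
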